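import Summits.ValiantsHypothesis.ValiantsHypothesis.Theorems.KPlusLogSqLawTridiagonalRealStaticCutLaw
import Summits.ValiantsHypothesis.ValiantsHypothesis.Theorems.KPlusLogSqLawTridiagonalRealStaticLadderMoves
import Summits.ValiantsHypothesis.ValiantsHypothesis.Theorems.KPlusLogSqLawTridiagonalRealStaticPotentialRow

/-!
# Route «KPlusLogSqLaw», crux `WeakLifting` (stmt-ValiantsHypothesis-19561) — REAL side of the tridiagonal sector:
# the DOUBLING LAW — gluing a design to its mirror image doubles every certified row (`B(2m) ≥ 2·B(m)`, all sizes)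

HONEST FRAMING.  Helper (`--supports stmt-ValiantsHypothesis-19561 --as helper`), seat val-sym-lift-p3 (g13), cell `pub-symmetroid`, 2026-08-28,
α register (static definite symmetric tridiagonal monomial designs), LOWER side.  All-sizes form of the mechanism behind the seat's rows
`…TridiagonalRealStaticTenFifteen` (15 at m = 10), `…TwelveNineteen` (19 at m = 12), `…FourteenTwentyThree` (23 at m = 14).  In the continuant
currency `pathDet a d b f` of `…TridiagonalRealStaticPotentialDefs`:
* `pathDet_reverse` — REVERSAL INVARIANCE: reading a design backwards does not change its determinant (conjugation by the reversal permutation);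
* `pathDet_shiftExp` — raising every exponent by `s` multiplies `D_k` by `X^{k s}`;
* `pathDet_double` — the design of size `2(n+1)` obtained by gluing the block `(a, d, b, f)` of size `n + 1` to its MIRROR IMAGE with exponents
  raised by `s`, through one constant link `β`, has determinant `X^{n s} · (X^s · D_{n+1}² − β² · D_n²)` (two-sided splitting
  `StaticTridiagonalRealCut.pathDet_split_two_sided` + reversal + shift) — it FACTORISES as `(X^{s/2}D_{n+1} − βD_n)(X^{s/2}D_{n+1} + βD_n)` for even `s`;
* `double_row` — THE DOUBLING LAW: if the links are nonzero and `D_{n+1}` alternates in sign along `Z + 1` positive points, then for a suitable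
  `β > 0` the doubled determinant alternates along `2Z + 1` points (each old point, where `X^s D_{n+1}²` wins for small `β`, interleaved with a zero
  of `D_{n+1}` between consecutive old points, where the value is `−β² D_n² < 0` because consecutive continuants share no positive zero): at least
  `2Z` distinct positive zeros.  (The extra far-left transition used in the seat's rows, giving `2Z + 1`, is not formalised here.)
Nothing here is an upper bound; nothing bears on `WeakLifting` / `TropicalB` (stmt-19771) in their windows, Conjecture B, the Door-A registers,
`MatrixDescartes` (stmt-ValiantsHypothesis-18050) or VP ≠ VNP.
[mechanism: this seat's symmetric doubling; folklore: continuants, reversal symmetry, intermediate values]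
-/

-- `Summit.ValiantsHypothesis.ValiantsHypothesis.…` repeats a component by the D-0017 layout (single-conjunct summit); the name is mandated.
set_option linter.dupNamespace false
set_option autoImplicit false

namespace Summit.ValiantsHypothesis.ValiantsHypothesis.Theorems.KPlusLogSqLaw.StaticTridiagonalRealDoubling

open Polynomial
open Summit.ValiantsHypothesis.ValiantsHypothesis.Theorems.ValuativeFlip (ctPath ctPath_apply)
open Summit.ValiantsHypothesis.ValiantsHypothesis.Theorems.KPlusLogSqLaw.StaticTridiagonalRealPotential
  (pathDet pathDet_congr eval_pathDet_succ_ne_zero)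
open Summit.ValiantsHypothesis.ValiantsHypothesis.Theorems.KPlusLogSqLaw.StaticTridiagonalRealCut (pathDet_split_two_sided)
open Summit.ValiantsHypothesis.ValiantsHypothesis.Theorems.KPlusLogSqLaw.StaticTridiagonalRealLadder
  (le_card_posRoots_of_isChain ne_zero_of_isChain_alt)

variable (a : ℕ → ℝ) (d : ℕ → ℕ) (b : ℕ → ℝ) (f : ℕ → ℕ)

/-! ### §1 Reversal invariance and exponent shift -/

/-- **Reversal invariance of the continuant**: the design read backwards (`a (k−1−t)`, `d (k−1−t)`, links `b (k−2−t)`, `f (k−2−t)`) has the same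
determinant — the reversed path matrix is the conjugate of the original by the reversal permutation. [folklore] -/
theorem pathDet_reverse (k : ℕ) :
    pathDet (fun t => a (k - 1 - t)) (fun t => d (k - 1 - t)) (fun t => b (k - 2 - t)) (fun t => f (k - 2 - t)) k =
      pathDet a d b f k := by
  unfold pathDet
  rw [← Matrix.det_submatrix_equiv_self Fin.revPerm
    (ctPath (fun t => C (a t) * X ^ d t) (fun t => C (b t) * X ^ f t) (fun t => C (b (t - 1)) * X ^ f (t - 1)) k)]
  congr 1
  refine Matrix.ext fun x y => ?_
  simp only [Matrix.submatrix_apply, Fin.revPerm_apply, ctPath_apply, Fin.val_rev]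
  have hx := x.isLt
  have hy := y.isLt
  by_cases h1 : (y : ℕ) = x
  · rw [if_pos h1, if_pos (show k - ((y : ℕ) + 1) = k - ((x : ℕ) + 1) by omega),
      show k - 1 - (x : ℕ) = k - ((x : ℕ) + 1) by omega]
  · rw [if_neg h1, if_neg (show ¬ (k - ((y : ℕ) + 1) = k - ((x : ℕ) + 1)) by omega)]
    by_cases h2 : (y : ℕ) = x + 1
    · rw [if_pos h2, if_neg (show ¬ (k - ((y : ℕ) + 1) = k - ((x : ℕ) + 1) + 1) by omega),
        if_pos (show k - ((x : ℕ) + 1) = k - ((y : ℕ) + 1) + 1 by omega),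
        show k - 2 - (x : ℕ) = k - ((x : ℕ) + 1) - 1 by omega]
    · rw [if_neg h2]
      by_cases h3 : (x : ℕ) = y + 1
      · rw [if_pos h3, if_pos (show k - ((y : ℕ) + 1) = k - ((x : ℕ) + 1) + 1 by omega),
          show k - 2 - ((x : ℕ) - 1) = k - ((x : ℕ) + 1) by omega]
      · rw [if_neg h3, if_neg (show ¬ (k - ((y : ℕ) + 1) = k - ((x : ℕ) + 1) + 1) by omega),
          if_neg (show ¬ (k - ((x : ℕ) + 1) = k - ((y : ℕ) + 1) + 1) by omega)]

/-- **Exponent shift**: raising every diagonal and link exponent by `s` multiplies `D_k` by `X^{k·s}`. [folklore] -/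
theorem pathDet_shiftExp (s k : ℕ) :
    pathDet a (fun t => d t + s) b (fun t => f t + s) k = (X : ℝ[X]) ^ (k * s) * pathDet a d b f k := by
  unfold pathDet
  have hM : ctPath (fun t => C (a t) * X ^ (d t + s)) (fun t => C (b t) * X ^ (f t + s))
      (fun t => C (b (t - 1)) * X ^ (f (t - 1) + s)) k =
      ((X : ℝ[X]) ^ s) • ctPath (fun t => C (a t) * X ^ d t) (fun t => C (b t) * X ^ f t)
        (fun t => C (b (t - 1)) * X ^ f (t - 1)) k := by
    refine Matrix.ext fun x y => ?_
    simp only [ctPath_apply, Matrix.smul_apply, smul_eq_mul]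
    split_ifs <;> ring
  rw [hM, Matrix.det_smul, Fintype.card_fin, ← pow_mul, mul_comm s k]

/-! ### §2 The doubled design and its factorised determinant -/

/-- **The doubled design factorises.**  Block `(a, d, b, f)` of size `n + 1`; the doubled design of size `2n + 2` has diagonal data
`t ↦ a t, d t` for `t ≤ n` and `t ↦ a (2n+1−t), d (2n+1−t) + s` for `t ≥ n + 1` (the mirror image, exponents raised by `s`), link data `b t, f t`
for `t < n`, the coupling link `β · X⁰` at `t = n`, and `b (2n−t), f (2n−t) + s` for `n < t ≤ 2n`.  Its determinant is
`X^{n s} · (X^s · D_{n+1}² − β² · D_n²)`. [this seat: splitting + reversal + shift] -/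
theorem pathDet_double (n s : ℕ) (β : ℝ) :
    pathDet (fun t => if t ≤ n then a t else a (2 * n + 1 - t)) (fun t => if t ≤ n then d t else d (2 * n + 1 - t) + s)
        (fun t => if t < n then b t else if t = n then β else b (2 * n - t))
        (fun t => if t < n then f t else if t = n then 0 else f (2 * n - t) + s) (2 * n + 2) =
      (X : ℝ[X]) ^ (n * s) * ((X : ℝ[X]) ^ s * pathDet a d b f (n + 1) ^ 2 - C (β ^ 2) * pathDet a d b f n ^ 2) := by
  rw [show 2 * n + 2 = n + 2 + n by ring, pathDet_split_two_sided]
  -- the left block and its leading minor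
  have h1 : pathDet (fun t => if t ≤ n then a t else a (2 * n + 1 - t)) (fun t => if t ≤ n then d t else d (2 * n + 1 - t) + s)
      (fun t => if t < n then b t else if t = n then β else b (2 * n - t))
      (fun t => if t < n then f t else if t = n then 0 else f (2 * n - t) + s) (n + 1) = pathDet a d b f (n + 1) :=
    pathDet_congr (fun t ht => by rw [if_pos (by omega)]) (fun t ht => by rw [if_pos (by omega)])
      (fun t ht => by rw [if_pos (by omega)]) (fun t ht => by rw [if_pos (by omega)])
  have h0 : pathDet (fun t => if t ≤ n then a t else a (2 * n + 1 - t)) (fun t => if t ≤ n then d t else d (2 * n + 1 - t) + s)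
      (fun t => if t < n then b t else if t = n then β else b (2 * n - t))
      (fun t => if t < n then f t else if t = n then 0 else f (2 * n - t) + s) n = pathDet a d b f n :=
    pathDet_congr (fun t ht => by rw [if_pos (by omega)]) (fun t ht => by rw [if_pos (by omega)])
      (fun t ht => by rw [if_pos (by omega)]) (fun t ht => by rw [if_pos (by omega)])
  -- the right block = mirror image, exponents + s: reversal and shift
  have h2 : pathDet (fun t => (fun t => if t ≤ n then a t else a (2 * n + 1 - t)) (t + (n + 1)))
      (fun t => (fun t => if t ≤ n then d t else d (2 * n + 1 - t) + s) (t + (n + 1)))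
      (fun t => (fun t => if t < n then b t else if t = n then β else b (2 * n - t)) (t + (n + 1)))
      (fun t => (fun t => if t < n then f t else if t = n then 0 else f (2 * n - t) + s) (t + (n + 1))) (n + 1) =
      (X : ℝ[X]) ^ ((n + 1) * s) * pathDet a d b f (n + 1) := by
    rw [← pathDet_reverse a d b f (n + 1), ← pathDet_shiftExp]
    refine pathDet_congr (fun t ht => ?_) (fun t ht => ?_) (fun t ht => ?_) (fun t ht => ?_)
    · simp only; rw [if_neg (by omega), show 2 * n + 1 - (t + (n + 1)) = n + 1 - 1 - t by omega]
    · simp only; rw [if_neg (by omega), show 2 * n + 1 - (t + (n + 1)) = n + 1 - 1 - t by omega]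
    · simp only; rw [if_neg (by omega), if_neg (by omega), show 2 * n - (t + (n + 1)) = n + 1 - 2 - t by omega]
    · simp only; rw [if_neg (by omega), if_neg (by omega), show 2 * n - (t + (n + 1)) = n + 1 - 2 - t by omega]
  have h3 : pathDet (fun t => (fun t => if t ≤ n then a t else a (2 * n + 1 - t)) (t + (n + 2)))
      (fun t => (fun t => if t ≤ n then d t else d (2 * n + 1 - t) + s) (t + (n + 2)))
      (fun t => (fun t => if t < n then b t else if t = n then β else b (2 * n - t)) (t + (n + 2)))
      (fun t => (fun t => if t < n then f t else if t = n then 0 else f (2 * n - t) + s) (t + (n + 2))) n =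
      (X : ℝ[X]) ^ (n * s) * pathDet a d b f n := by
    rw [← pathDet_reverse a d b f n, ← pathDet_shiftExp]
    refine pathDet_congr (fun t ht => ?_) (fun t ht => ?_) (fun t ht => ?_) (fun t ht => ?_)
    · simp only; rw [if_neg (by omega), show 2 * n + 1 - (t + (n + 2)) = n - 1 - t by omega]
    · simp only; rw [if_neg (by omega), show 2 * n + 1 - (t + (n + 2)) = n - 1 - t by omega]
    · simp only; rw [if_neg (by omega), if_neg (by omega), show 2 * n - (t + (n + 2)) = n - 2 - t by omega]
    · simp only; rw [if_neg (by omega), if_neg (by omega), show 2 * n - (t + (n + 2)) = n - 2 - t by omega]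
  rw [h1, h0, h2, h3,
    show (if n < n then b n else if n = n then β else b (2 * n - n)) = β by simp,
    show (if n < n then f n else if n = n then 0 else f (2 * n - n) + s) = 0 by simp,
    pow_zero, mul_one, map_pow]
  ring

/-! ### §3 The doubling law -/

/-- A small coupling: for finitely many points `τ > 0` with `P(τ) ≠ 0` there is `β > 0` with `β² Q(τ)² < τ^s P(τ)²` at all of them. [folklore] -/
theorem exists_small_coupling (P Q : ℝ → ℝ) (s : ℕ) :
    ∀ L : List ℝ, (∀ τ ∈ L, 0 < τ ∧ P τ ≠ 0) → ∃ β : ℝ, 0 < β ∧ ∀ τ ∈ L, β ^ 2 * Q τ ^ 2 < τ ^ s * P τ ^ 2 := by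
  intro L
  induction L with
  | nil => intro _; exact ⟨1, one_pos, fun τ hτ => by simp at hτ⟩
  | cons τ L ih =>
    intro hL
    obtain ⟨β, hβ, hβL⟩ := ih (fun u hu => hL u (List.mem_cons_of_mem _ hu))
    obtain ⟨hτ, hP⟩ := hL τ (by simp)
    have hA : 0 < τ ^ s * P τ ^ 2 := by positivity
    -- choose β' ≤ β with β'² Q(τ)² < A
    by_cases hQ : Q τ = 0
    · exact ⟨β, hβ, fun u hu => by
        rcases List.mem_cons.mp hu with rfl | hu
        · rw [hQ]; simpa using hA
        · exact hβL u hu⟩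
    · have hQ2 : 0 < Q τ ^ 2 := by positivity
      set γ : ℝ := min β (Real.sqrt (τ ^ s * P τ ^ 2 / Q τ ^ 2) / 2) with hγ
      have hroot : 0 < Real.sqrt (τ ^ s * P τ ^ 2 / Q τ ^ 2) := Real.sqrt_pos.mpr (div_pos hA hQ2)
      have hγpos : 0 < γ := lt_min hβ (by linarith)
      have hγβ : γ ≤ β := min_le_left _ _
      have hγr : γ ≤ Real.sqrt (τ ^ s * P τ ^ 2 / Q τ ^ 2) / 2 := min_le_right _ _
      refine ⟨γ, hγpos, fun u hu => ?_⟩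
      rcases List.mem_cons.mp hu with rfl | hu
      · have hsq : Real.sqrt (u ^ s * P u ^ 2 / Q u ^ 2) ^ 2 = u ^ s * P u ^ 2 / Q u ^ 2 :=
          Real.sq_sqrt (div_pos hA hQ2).le
        have hγ2 : γ ^ 2 ≤ (Real.sqrt (u ^ s * P u ^ 2 / Q u ^ 2) / 2) ^ 2 := by
          exact pow_le_pow_left₀ hγpos.le hγr 2
        have : γ ^ 2 < u ^ s * P u ^ 2 / Q u ^ 2 := by nlinarith [hsq, hγ2, div_pos hA hQ2]
        calc γ ^ 2 * Q u ^ 2 < (u ^ s * P u ^ 2 / Q u ^ 2) * Q u ^ 2 := by gcongr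
          _ = u ^ s * P u ^ 2 := by field_simp
      · have h := hβL u hu
        have hγ2 : γ ^ 2 ≤ β ^ 2 := pow_le_pow_left₀ hγpos.le hγβ 2
        nlinarith [hγ2, sq_nonneg (Q u)]

/-- Interleaving: if `E > 0` at every point of an alternation list of the continuous function `P` and `E < 0` at every positive zero of `P`, then `E`
alternates along a list of `2·|L| − 1` positive increasing points starting at the head of `L`. [folklore: intermediate values] -/
theorem exists_interleave (P E : ℝ → ℝ) (hP : Continuous P) (hzero : ∀ r, 0 < r → P r = 0 → E r < 0) :
    ∀ (L : List ℝ) (τ : ℝ), (τ :: L).IsChain (· < ·) → (∀ u ∈ τ :: L, 0 < u ∧ 0 < E u) →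
      (τ :: L).IsChain (fun x y => P x * P y < 0) →
      ∃ L' : List ℝ, L'.length = 2 * L.length ∧ (τ :: L').IsChain (· < ·) ∧ (∀ u ∈ τ :: L', 0 < u) ∧
        (τ :: L').IsChain (fun x y => E x * E y < 0) := by
  intro L
  induction L with
  | nil =>
    intro τ _ hpos _
    exact ⟨[], rfl, List.isChain_singleton _, fun u hu => (hpos u hu).1, List.isChain_singleton _⟩
  | cons τ' L ih =>
    intro τ hlt hpos halt
    have hττ' : τ < τ' := (List.isChain_cons_cons.mp hlt).1
    have hPP : P τ * P τ' < 0 := (List.isChain_cons_cons.mp halt).1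
    obtain ⟨L', hlen, hlt', hpos', halt'⟩ := ih τ' (List.isChain_cons_cons.mp hlt).2
      (fun u hu => hpos u (List.mem_cons_of_mem _ hu)) (List.isChain_cons_cons.mp halt).2
    -- a zero of `P` strictly between `τ` and `τ'`
    obtain ⟨r, hr, hPr⟩ : ∃ r ∈ Set.Ioo τ τ', P r = 0 := by
      rcases mul_neg_iff.mp hPP with ⟨h1, h2⟩ | ⟨h1, h2⟩
      · have := intermediate_value_Ioo' hττ'.le hP.continuousOn
        exact ⟨_, (this ⟨h2, h1⟩).choose_spec.1, (this ⟨h2, h1⟩).choose_spec.2⟩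
      · have := intermediate_value_Ioo hττ'.le hP.continuousOn
        exact ⟨_, (this ⟨h1, h2⟩).choose_spec.1, (this ⟨h1, h2⟩).choose_spec.2⟩
    have hτpos : 0 < τ := (hpos τ (by simp)).1
    have hrpos : 0 < r := hτpos.trans hr.1
    have hEr : E r < 0 := hzero r hrpos hPr
    have hEτ : 0 < E τ := (hpos τ (by simp)).2
    have hEτ' : 0 < E τ' := (hpos τ' (by simp)).2
    refine ⟨r :: τ' :: L', by simp [hlen]; ring, ?_, ?_, ?_⟩
    · exact List.isChain_cons_cons.mpr ⟨hr.1, List.isChain_cons_cons.mpr ⟨hr.2, hlt'⟩⟩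
    · intro u hu
      rcases List.mem_cons.mp hu with rfl | hu
      · exact hτpos
      rcases List.mem_cons.mp hu with rfl | hu
      · exact hrpos
      exact hpos' u hu
    · exact List.isChain_cons_cons.mpr ⟨by nlinarith, List.isChain_cons_cons.mpr ⟨by nlinarith, halt'⟩⟩

/-- **THE DOUBLING LAW (all sizes).**  If the links of the block `(a, d, b, f)` are nonzero and its top continuant `D_{n+1}` alternates in sign
along a strictly increasing list `τ :: L` of positive points (`|L|` certified zeros), then for every shift `s` there is a coupling `β > 0` such that
the determinant of the doubled design of size `2n + 2` (`pathDet_double`) alternates along `2|L| + 1` positive points: at least `2|L|` distinct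
positive zeros.  **`B(2m) ≥ 2·B(m)` for certified rows.** [this seat] -/
theorem double_row (hb : ∀ t, b t ≠ 0) (n s : ℕ) (τ : ℝ) (L : List ℝ)
    (hlt : (τ :: L).IsChain (· < ·)) (hpos : ∀ u ∈ τ :: L, 0 < u)
    (halt : (τ :: L).IsChain (fun x y => (pathDet a d b f (n + 1)).eval x * (pathDet a d b f (n + 1)).eval y < 0)) :
    ∃ β : ℝ, 0 < β ∧ 2 * L.length ≤
      ((pathDet (fun t => if t ≤ n then a t else a (2 * n + 1 - t)) (fun t => if t ≤ n then d t else d (2 * n + 1 - t) + s)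
        (fun t => if t < n then b t else if t = n then β else b (2 * n - t))
        (fun t => if t < n then f t else if t = n then 0 else f (2 * n - t) + s) (2 * n + 2)).roots.toFinset.filter
          (fun t => 0 < t)).card := by
  rcases L with _ | ⟨τ', L⟩
  · exact ⟨1, one_pos, by simp⟩
  -- nonvanishing of `D_{n+1}` at the certificate points
  have hne : ∀ u ∈ τ :: τ' :: L, (pathDet a d b f (n + 1)).eval u ≠ 0 := ne_zero_of_isChain_alt halt
  -- the coupling
  obtain ⟨β, hβ, hβL⟩ := exists_small_coupling (fun x => (pathDet a d b f (n + 1)).eval x)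
    (fun x => (pathDet a d b f n).eval x) s (τ :: τ' :: L) (fun u hu => ⟨hpos u hu, hne u hu⟩)
  refine ⟨β, hβ, ?_⟩
  -- the doubled determinant at a real point
  have hev : ∀ x : ℝ, (pathDet (fun t => if t ≤ n then a t else a (2 * n + 1 - t))
      (fun t => if t ≤ n then d t else d (2 * n + 1 - t) + s)
      (fun t => if t < n then b t else if t = n then β else b (2 * n - t))
      (fun t => if t < n then f t else if t = n then 0 else f (2 * n - t) + s) (2 * n + 2)).eval x =
      x ^ (n * s) * (x ^ s * (pathDet a d b f (n + 1)).eval x ^ 2 - β ^ 2 * (pathDet a d b f n).eval x ^ 2) := by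
    intro x
    rw [pathDet_double]
    simp only [eval_mul, eval_sub, eval_pow, eval_X, eval_C]
  -- signs: positive at the certificate points, negative at the positive zeros of `D_{n+1}`
  have hEpos : ∀ u ∈ τ :: τ' :: L, 0 < u ∧
      0 < u ^ (n * s) * (u ^ s * (pathDet a d b f (n + 1)).eval u ^ 2 - β ^ 2 * (pathDet a d b f n).eval u ^ 2) := by
    intro u hu
    have hu0 : 0 < u := hpos u hu
    have h := hβL u hu
    refine ⟨hu0, mul_pos (pow_pos hu0 _) ?_⟩
    linarith [h]
  have hEneg : ∀ r : ℝ, 0 < r → (pathDet a d b f (n + 1)).eval r = 0 →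
      r ^ (n * s) * (r ^ s * (pathDet a d b f (n + 1)).eval r ^ 2 - β ^ 2 * (pathDet a d b f n).eval r ^ 2) < 0 := by
    intro r hr hPr
    have hQ : (pathDet a d b f n).eval r ≠ 0 := fun hQ => eval_pathDet_succ_ne_zero a d b f hb hr n hQ hPr
    rw [hPr]
    have hQ2 : 0 < (pathDet a d b f n).eval r ^ 2 := by positivity
    have : r ^ s * (0 : ℝ) ^ 2 - β ^ 2 * (pathDet a d b f n).eval r ^ 2 < 0 := by
      have := mul_pos (pow_pos hβ 2) hQ2
      simp only [ne_eq, OfNat.ofNat_ne_zero, not_false_eq_true, zero_pow, mul_zero, zero_sub, Left.neg_neg_iff]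
      exact this
    exact mul_neg_of_pos_of_neg (pow_pos hr _) this
  -- interleave the zeros
  obtain ⟨L', hlen, hlt', hpos', halt'⟩ := exists_interleave (fun x => (pathDet a d b f (n + 1)).eval x)
    (fun x => x ^ (n * s) * (x ^ s * (pathDet a d b f (n + 1)).eval x ^ 2 - β ^ 2 * (pathDet a d b f n).eval x ^ 2))
    (Polynomial.continuous _) hEneg (τ' :: L) τ hlt hEpos halt
  have hchain : (τ :: L').IsChain (fun x y =>
      (pathDet (fun t => if t ≤ n then a t else a (2 * n + 1 - t)) (fun t => if t ≤ n then d t else d (2 * n + 1 - t) + s)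
        (fun t => if t < n then b t else if t = n then β else b (2 * n - t))
        (fun t => if t < n then f t else if t = n then 0 else f (2 * n - t) + s) (2 * n + 2)).eval x *
      (pathDet (fun t => if t ≤ n then a t else a (2 * n + 1 - t)) (fun t => if t ≤ n then d t else d (2 * n + 1 - t) + s)
        (fun t => if t < n then b t else if t = n then β else b (2 * n - t))
        (fun t => if t < n then f t else if t = n then 0 else f (2 * n - t) + s) (2 * n + 2)).eval y < 0) := by
    refine List.IsChain.imp (fun x y (hxy : _ < 0) => ?_) halt'
    rw [hev x, hev y]
    exact hxy
  have hcount := le_card_posRoots_of_isChain _ (τ :: L') hlt' hpos' hchain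
  simp only [List.length_cons] at hcount hlen ⊢
  omega

end Summit.ValiantsHypothesis.ValiantsHypothesis.Theorems.KPlusLogSqLaw.StaticTridiagonalRealDoubling
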